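import Summits.QuantumFields.GaugeBoot.DiagonalRPTorusSignMonomials
import HarnessLib

/-!
# The `ℤ₂` character expansion on `(ℤ/L)³` and the Polyakov-pair form (gauge-boot, L3(λ), 2/3)

HONEST FRAMING (cell `pub-gaugeboot`, page 1 of every file): the venture produces certified bounds
on lattice expectations at stated coupling, gauge group, dimension and torus size; NOT a mass gap,
NOT a continuum limit, NOT a string tension; NOT Yang–Mills-summit-bearing (barriers
`FixedCouplingUltralocality`, `PerturbativeInvisibility`). Second of three modules
(`DiagonalRPTorusSignMonomials` → this → `DiagonalRPTorusNegativeThree`); bookkeeping and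
elementary estimates for a general torus size `L`, discharging nothing by itself.

## Content

* `bw ρ t U = ∏ₚ (1 + t σ(U_p))` and the **character expansion of the Boltzmann weight** of a
  `{1,-1}`-valued one-dimensional representation:
  `e^(-β S(U)) = (e^(-β) cosh β)^#plaquettes · bw ρ (tanh β) U` (`exp_neg_mul_wilsonAction`).
* `jind S A B = [∂S = column A + column B]`, `ksum t A B = Σ_(S ⊆ plaquettes) t^|S| · jind S A B`
  and **`integral_bw_mul_pol`**: `∫ bw · P_A · P_B ∏ dU_e = ksum t A B` (expand with
  `Finset.prod_one_add`, integrate the link monomials term by term with `integral_mono`).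
* Generic bounds: `t^|S₀| ≤ ksum t A B` for any `S₀` with boundary `A + B` (`pow_card_le_ksum`);
  `ksum t A B ≤ (t/u)^n (1+u)^#plaquettes` if every `S` with boundary `A + B` has at least `n`
  plaquettes (`ksum_le_of_le_card`, from `Σ_S u^|S| = (1+u)^#plaquettes`); `tanh β ≤ β + β²/2`.
* The Polyakov-pair witness `polDiff X Y = P_X - P_Y` (as a complex observable): measurable,
  `‖·‖ ≤ 2`, `Θ`-image `P_{θX} - P_{θY}`, and the two identities that reduce
  `⟨(Θ polDiff)‾ polDiff⟩_{Λ,β}` to the four-term combination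
  `K(θX,X) - K(θX,Y) - K(θY,X) + K(θY,Y)` times the positive factor
  `Z⁻¹ (e^(-β) cosh β)^#plaquettes` (`integral_exp_mul_polPair`,
  `wilsonExpectation_polDiff`); hence **`wilsonExpectation_polDiff_neg`**: a negative
  combination makes the RP form negative.

Sources: Osterwalder–Seiler, Ann. Phys. 110 (1978) 440, §2; Kazakov–Zheng, arXiv:2203.11360 §3.1.
Elementary; not in print as theorems as far as the cell's searches go.
Printed precedent (nearest-neighbour spin systems, a remark without proof): periodic boundary conditions destroy
diagonal RP — Fröhlich–Israel–Lieb–Simon, J. Stat. Phys. 22 (1980) 297, §3 (Model 3.1); M. Biskup, in LNM 1970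
(2009) §5.5; the statements here are theorem-level, gauge-theoretic forms of that obstruction (tribunal t2 F-R1).
-/

open MeasureTheory Complex Finset
open scoped ComplexOrder

namespace Summit.QuantumFields.GaugeBoot

open Literature.MathematicalPhysics.QuantumFieldTheory

namespace DiagRPThree

/-! ## The `ℤ₂` character expansion of the Boltzmann weight and of `⟨P_A P_B⟩` -/

section Expansion

variable {L : ℕ} [NeZero L] {G : Type*} [Group G] (ρ : G →* Matrix (Fin 1) (Fin 1) ℂ)

/-- `W_t(U) = ∏ₚ (1 + t σ(U_p))`. -/
def bw (t : ℝ) (U : GaugeConfig 3 L G) : ℝ := ∏ p, (1 + t * splaq ρ p U)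

/-- The parity indicator `J_S(A,B) = [∂S = column A + column B] ∈ {0, 1}`. -/
def jind (S : Finset (Plaquette 3 L)) (A B : ZMod L × ZMod L) : ℝ :=
  if ∀ e : Edge 3 L, Even (degS S e + ccnt A e + ccnt B e) then 1 else 0

/-- `K_t(A,B) = Σ_{S ⊆ plaquettes} t^{|S|} J_S(A,B)` — the numerator of `⟨P_A P_B⟩` up to the
common factor `(e^{-β} cosh β)^#plaquettes`, before division by `Z`. -/
def ksum (t : ℝ) (A B : ZMod L × ZMod L) : ℝ :=
  ∑ S ∈ (univ : Finset (Plaquette 3 L)).powerset, t ^ S.card * jind S A B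

variable {ρ}

/-- `e^{-β(1-s)} = e^{-β} cosh β · (1 + tanh β · s)` for `s = ±1`. -/
theorem exp_neg_mul_one_sub {s : ℝ} (hs : s = 1 ∨ s = -1) (β : ℝ) :
    Real.exp (-β * (1 - s)) = Real.exp (-β) * Real.cosh β * (1 + Real.tanh β * s) := by
  have hc : Real.cosh β ≠ 0 := (Real.cosh_pos β).ne'
  rw [Real.tanh_eq_sinh_div_cosh]
  rcases hs with h | h <;> rw [h]
  · rw [sub_self, mul_zero, Real.exp_zero, mul_one,
      show Real.exp (-β) * Real.cosh β * (1 + Real.sinh β / Real.cosh β) =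
        Real.exp (-β) * (Real.cosh β + Real.sinh β) by field_simp,
      Real.cosh_add_sinh, ← Real.exp_add, neg_add_cancel, Real.exp_zero]
  · rw [mul_neg, mul_one,
      show Real.exp (-β) * Real.cosh β * (1 + -(Real.sinh β / Real.cosh β)) =
        Real.exp (-β) * (Real.cosh β - Real.sinh β) by field_simp; ring,
      Real.cosh_sub_sinh, ← Real.exp_add]
    congr 1
    ring

/-- The Wilson action of a `{±1}`-valued one-dimensional representation:
`S(U) = Σₚ (1 - σ(U_p))`. -/
theorem wilsonAction_eq_sum_splaq (U : GaugeConfig 3 L G) :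
    wilsonAction ρ U = ∑ p, (1 - splaq ρ p U) := by
  unfold wilsonAction splaq
  simp only [Nat.cast_one, trace_re_eq_sgn]

/-- **Character expansion of the Boltzmann weight**:
`e^{-β S(U)} = (e^{-β} cosh β)^#plaquettes · ∏ₚ (1 + t σ(U_p))`, `t = tanh β`. -/
theorem exp_neg_mul_wilsonAction (hval : ∀ g, ρ g = 1 ∨ ρ g = -1) (β : ℝ)
    (U : GaugeConfig 3 L G) :
    Real.exp (-β * wilsonAction ρ U) =
      (Real.exp (-β) * Real.cosh β) ^ Fintype.card (Plaquette 3 L) * bw ρ (Real.tanh β) U := by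
  rw [wilsonAction_eq_sum_splaq, mul_sum, Real.exp_sum]
  rw [prod_congr rfl fun p _ => exp_neg_mul_one_sub (s := splaq ρ p U) (sgn_cases hval _) β]
  rw [prod_mul_distrib, prod_const, card_univ, bw]

/-- **Expansion of `W_t · P_A · P_B` into link monomials**:
`W_t(U) P_A(U) P_B(U) = Σ_S t^{|S|} ∏ₑ σ(U_e)^{deg_S(e) + [e ∈ A] + [e ∈ B]}`. -/
theorem bw_mul_pol (hval : ∀ g, ρ g = 1 ∨ ρ g = -1) (t : ℝ) (A B : ZMod L × ZMod L)
    (U : GaugeConfig 3 L G) :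
    bw ρ t U * pol ρ A U * pol ρ B U =
      ∑ S ∈ (univ : Finset (Plaquette 3 L)).powerset,
        t ^ S.card * mono ρ ((∑ p ∈ S, pcnt p) + ccnt A + ccnt B) U := by
  have hW : bw ρ t U = ∑ S ∈ (univ : Finset (Plaquette 3 L)).powerset,
      t ^ S.card * mono ρ (∑ p ∈ S, pcnt p) U := by
    unfold bw
    rw [prod_one_add]
    refine sum_congr rfl fun S _ => ?_
    rw [prod_mul_distrib, prod_const, mono_sum]
    exact congrArg _ (prod_congr rfl fun p _ => splaq_eq_mono hval p U)
  rw [hW, sum_mul, sum_mul]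
  refine sum_congr rfl fun S _ => ?_
  rw [mono_add, mono_add, pol, pol]
  ring

variable [TopologicalSpace G] [IsTopologicalGroup G] [CompactSpace G] [MeasurableSpace G]
  [BorelSpace G]

/-- Each term of the expansion is integrable (bounded by `|t|^{|S|}`, measurable). -/
theorem integrable_term (hρ : Continuous ρ) (hval : ∀ g, ρ g = 1 ∨ ρ g = -1) (t : ℝ)
    (S : Finset (Plaquette 3 L)) (m : Edge 3 L → ℕ) :
    Integrable (fun U : GaugeConfig 3 L G => t ^ S.card * mono ρ m U)
      (Measure.pi fun _ : Edge 3 L => haarProbability G) := by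
  refine Integrable.of_bound (((measurable_mono hρ m).const_mul _).aestronglyMeasurable)
    (|t| ^ S.card) (ae_of_all _ fun U => ?_)
  rw [Real.norm_eq_abs, abs_mul, abs_pow]
  exact mul_le_of_le_one_right (pow_nonneg (abs_nonneg _) _) (abs_mono_le hval m U)

/-- `W_t · P_A · P_B` is integrable. -/
theorem integrable_bw_mul_pol (hρ : Continuous ρ) (hval : ∀ g, ρ g = 1 ∨ ρ g = -1) (t : ℝ)
    (A B : ZMod L × ZMod L) :
    Integrable (fun U : GaugeConfig 3 L G => bw ρ t U * pol ρ A U * pol ρ B U)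
      (Measure.pi fun _ : Edge 3 L => haarProbability G) := by
  simp_rw [bw_mul_pol hval]
  exact integrable_finsetSum _ fun S _ => integrable_term hρ hval t S _

/-- **`∫ W_t P_A P_B ∏ dU_e = K_t(A,B)`**: integrate the expansion term by term. -/
theorem integral_bw_mul_pol (hρ : Continuous ρ) (hval : ∀ g, ρ g = 1 ∨ ρ g = -1)
    (hne : ∃ g, ρ g = -1) (t : ℝ) (A B : ZMod L × ZMod L) :
    ∫ U, bw ρ t U * pol ρ A U * pol ρ B U ∂(Measure.pi fun _ : Edge 3 L => haarProbability G) =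
      ksum t A B := by
  simp_rw [bw_mul_pol hval]
  rw [integral_finsetSum _ fun S _ => integrable_term hρ hval t S _, ksum]
  refine sum_congr rfl fun S _ => ?_
  rw [integral_const_mul, integral_mono hval hne, jind]
  simp_rw [expo_apply]

/-- **The Polyakov-pair integral.** For columns `X', Y', X, Y`:
`∫ e^{-βS} (P_{X'} - P_{Y'})(P_X - P_Y) ∏ dU_e
  = (e^{-β} cosh β)^#plaquettes · (K(X',X) - K(X',Y) - K(Y',X) + K(Y',Y))`, `K = ksum (tanh β)`. -/
theorem integral_exp_mul_polPair (hρ : Continuous ρ) (hval : ∀ g, ρ g = 1 ∨ ρ g = -1)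
    (hne : ∃ g, ρ g = -1) (β : ℝ) (X' Y' X Y : ZMod L × ZMod L) :
    ∫ U, Real.exp (-β * wilsonAction ρ U) *
        ((pol ρ X' U - pol ρ Y' U) * (pol ρ X U - pol ρ Y U))
        ∂(Measure.pi fun _ : Edge 3 L => haarProbability G) =
      (Real.exp (-β) * Real.cosh β) ^ Fintype.card (Plaquette 3 L) *
        (ksum (Real.tanh β) X' X - ksum (Real.tanh β) X' Y - ksum (Real.tanh β) Y' X +
          ksum (Real.tanh β) Y' Y) := by
  set t := Real.tanh β with ht
  set c : ℝ := (Real.exp (-β) * Real.cosh β) ^ Fintype.card (Plaquette 3 L) with hc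
  have hpt : ∀ U : GaugeConfig 3 L G, Real.exp (-β * wilsonAction ρ U) *
      ((pol ρ X' U - pol ρ Y' U) * (pol ρ X U - pol ρ Y U)) =
      c * (bw ρ t U * pol ρ X' U * pol ρ X U - bw ρ t U * pol ρ X' U * pol ρ Y U
        - bw ρ t U * pol ρ Y' U * pol ρ X U + bw ρ t U * pol ρ Y' U * pol ρ Y U) := fun U => by
    rw [exp_neg_mul_wilsonAction hval β U]
    ring
  simp_rw [hpt]
  have hi := fun A B => integrable_bw_mul_pol (L := L) (G := G) hρ hval t A B
  rw [integral_const_mul, integral_add, integral_sub, integral_sub,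
    integral_bw_mul_pol hρ hval hne, integral_bw_mul_pol hρ hval hne,
    integral_bw_mul_pol hρ hval hne, integral_bw_mul_pol hρ hval hne]
  · exact hi _ _
  · exact hi _ _
  · exact (hi _ _).sub (hi _ _)
  · exact hi _ _
  · exact ((hi _ _).sub (hi _ _)).sub (hi _ _)
  · exact hi _ _

end Expansion

/-! ## Generic bounds on `K_t(A,B)` -/

section Bounds

variable {L : ℕ} [NeZero L]

/-- `J_S(A,B) ∈ [0,1]`. -/
theorem jind_nonneg (S : Finset (Plaquette 3 L)) (A B : ZMod L × ZMod L) : 0 ≤ jind S A B := by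
  unfold jind
  split_ifs <;> norm_num

/-- `K_t(A,B) ≥ 0` for `t ≥ 0`. -/
theorem ksum_nonneg {t : ℝ} (ht : 0 ≤ t) (A B : ZMod L × ZMod L) : 0 ≤ ksum t A B :=
  sum_nonneg fun S _ => mul_nonneg (pow_nonneg ht _) (jind_nonneg S A B)

/-- **Lower bound from one surface**: if `S₀` has boundary `A + B`, then `K_t(A,B) ≥ t^{|S₀|}`. -/
theorem pow_card_le_ksum {t : ℝ} (ht : 0 ≤ t) {A B : ZMod L × ZMod L}
    {S₀ : Finset (Plaquette 3 L)}
    (hS₀ : ∀ e : Edge 3 L, Even (degS S₀ e + ccnt A e + ccnt B e)) :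
    t ^ S₀.card ≤ ksum t A B := by
  have hterm : t ^ S₀.card = t ^ S₀.card * jind S₀ A B := by
    rw [jind, if_pos hS₀, mul_one]
  rw [hterm, ksum]
  exact single_le_sum (f := fun S => t ^ S.card * jind S A B)
    (fun S _ => mul_nonneg (pow_nonneg ht _) (jind_nonneg S A B))
    (mem_powerset.2 (subset_univ S₀))

/-- `Σ_{S ⊆ plaquettes} u^{|S|} = (1+u)^#plaquettes`. -/
theorem sum_pow_card (u : ℝ) :
    ∑ S ∈ (univ : Finset (Plaquette 3 L)).powerset, u ^ S.card =
      (1 + u) ^ Fintype.card (Plaquette 3 L) := by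
  have h := Finset.sum_pow_mul_eq_add_pow u 1 (univ : Finset (Plaquette 3 L))
  simp only [one_pow, mul_one, card_univ] at h
  rw [h, add_comm]

/-- **Upper bound from a size estimate**: if every `S` with boundary `A + B` has at least `n`
plaquettes, then `K_t(A,B) ≤ (t/u)^n (1+u)^#plaquettes` for `0 ≤ t ≤ u`. -/
theorem ksum_le_of_le_card {t u : ℝ} (ht : 0 ≤ t) (htu : t ≤ u) (hu : 0 < u)
    {A B : ZMod L × ZMod L} {n : ℕ}
    (hn : ∀ S : Finset (Plaquette 3 L), (∀ e, Even (degS S e + ccnt A e + ccnt B e)) →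
      n ≤ S.card) :
    ksum t A B ≤ (t / u) ^ n * (1 + u) ^ Fintype.card (Plaquette 3 L) := by
  have hq0 : 0 ≤ t / u := div_nonneg ht hu.le
  have hq1 : t / u ≤ 1 := (div_le_one hu).2 htu
  rw [← sum_pow_card u, mul_sum, ksum]
  refine sum_le_sum fun S _ => ?_
  unfold jind
  split_ifs with h
  · rw [mul_one]
    calc t ^ S.card = (t / u) ^ S.card * u ^ S.card := by
          rw [← mul_pow, div_mul_cancel₀ _ hu.ne']
      _ ≤ (t / u) ^ n * u ^ S.card :=
          mul_le_mul_of_nonneg_right (pow_le_pow_of_le_one hq0 hq1 (hn S h))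
            (pow_nonneg hu.le _)
  · rw [mul_zero]
    exact mul_nonneg (pow_nonneg hq0 _) (pow_nonneg (by linarith) _)

/-- `tanh β ≤ β + β²/2` for `0 ≤ β ≤ 1` (`tanh ≤ sinh`, `e^β ≤ 1 + β + β²`, `e^{-β} ≥ 1 - β`). -/
theorem tanh_le_add_sq {β : ℝ} (h0 : 0 ≤ β) (h1 : β ≤ 1) : Real.tanh β ≤ β + β ^ 2 / 2 := by
  have hsinh : Real.tanh β ≤ Real.sinh β := by
    rw [Real.tanh_eq_sinh_div_cosh]
    exact div_le_self (Real.sinh_nonneg_iff.2 h0) (Real.one_le_cosh β)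
  have he1 : Real.exp β ≤ 1 + β + β ^ 2 := by
    have h := Real.abs_exp_sub_one_sub_id_le (x := β) (by rwa [abs_of_nonneg h0])
    have h' := (abs_le.1 h).2
    linarith
  have he2 : 1 - β ≤ Real.exp (-β) := by linarith [Real.add_one_le_exp (-β)]
  rw [Real.sinh_eq] at hsinh
  linarith

end Bounds

/-! ## The Polyakov-pair witness `P_X - P_Y` and its RP form -/

section Witness

variable {L : ℕ} [NeZero L] {G : Type*} [Group G] (ρ : G →* Matrix (Fin 1) (Fin 1) ℂ)

/-- The complex observable `P_X - P_Y` (difference of two Polyakov loops). -/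
def polDiff (X Y : ZMod L × ZMod L) (U : GaugeConfig 3 L G) : ℂ :=
  ((pol ρ X U - pol ρ Y U : ℝ) : ℂ)

variable {ρ}

/-- `‖P_X - P_Y‖ ≤ 2`. -/
theorem norm_polDiff_le (hval : ∀ g, ρ g = 1 ∨ ρ g = -1) (X Y : ZMod L × ZMod L)
    (U : GaugeConfig 3 L G) : ‖polDiff ρ X Y U‖ ≤ 2 := by
  rw [polDiff, Complex.norm_real, Real.norm_eq_abs]
  have h1 := abs_mono_le hval (ccnt X) U
  have h2 := abs_mono_le hval (ccnt Y) U
  unfold pol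
  exact (abs_sub _ _).trans (by linarith)

/-- `Θ(P_X - P_Y) = P_{θX} - P_{θY}`. -/
theorem polDiff_configDiagSwap (X Y : ZMod L × ZMod L) (U : GaugeConfig 3 L G) :
    polDiff ρ X Y (configDiagSwap 0 1 U) = ((pol ρ X.swap U - pol ρ Y.swap U : ℝ) : ℂ) := by
  simp only [polDiff, pol_configDiagSwap]

/-- `P_X - P_Y` depends only on the links of the two columns. -/
theorem polDiff_congr (X Y : ZMod L × ZMod L) {U V : GaugeConfig 3 L G}
    (h : ∀ e : Edge 3 L, ccnt X e ≠ 0 ∨ ccnt Y e ≠ 0 → U e = V e) :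
    polDiff ρ X Y U = polDiff ρ X Y V := by
  simp only [polDiff, pol_congr X fun e he => h e (Or.inl he),
    pol_congr Y fun e he => h e (Or.inr he)]

variable [TopologicalSpace G] [IsTopologicalGroup G] [CompactSpace G] [MeasurableSpace G]
  [BorelSpace G]

omit [IsTopologicalGroup G] [CompactSpace G] in
/-- `P_X - P_Y` is measurable. -/
theorem measurable_polDiff (hρ : Continuous ρ) (X Y : ZMod L × ZMod L) :
    Measurable (polDiff ρ X Y : GaugeConfig 3 L G → ℂ) :=
  Complex.measurable_ofReal.comp ((measurable_mono hρ _).sub (measurable_mono hρ _))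

/-- **The RP form of the Polyakov-pair witness.** With `F = P_X - P_Y`:
`⟨(ΘF)‾ F⟩_{Λ,β} = Z⁻¹ (e^{-β} cosh β)^#plaquettes · (K(θX,X) - K(θX,Y) - K(θY,X) + K(θY,Y))`,
`K = ksum (tanh β)`, `θ(a,b) = (b,a)`, as a real number cast to `ℂ`. -/
theorem wilsonExpectation_polDiff (hρ : Continuous ρ) (hval : ∀ g, ρ g = 1 ∨ ρ g = -1)
    (hne : ∃ g, ρ g = -1) (β : ℝ) (X Y : ZMod L × ZMod L) :
    wilsonExpectation ρ β
        (fun U => (starRingEnd ℂ) (polDiff ρ X Y (configDiagSwap 0 1 U)) * polDiff ρ X Y U) =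
      ((((partitionFunction (d := 3) (L := L) ρ β)⁻¹).toReal *
        ((Real.exp (-β) * Real.cosh β) ^ Fintype.card (Plaquette 3 L) *
          (ksum (Real.tanh β) X.swap X - ksum (Real.tanh β) X.swap Y -
            ksum (Real.tanh β) Y.swap X + ksum (Real.tanh β) Y.swap Y)) : ℝ) : ℂ) := by
  set g : GaugeConfig 3 L G → ℝ := fun U =>
    (pol ρ X.swap U - pol ρ Y.swap U) * (pol ρ X U - pol ρ Y U) with hg
  have hfun : (fun U => (starRingEnd ℂ) (polDiff ρ X Y (configDiagSwap 0 1 U)) *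
      polDiff ρ X Y U) = fun U => ((g U : ℝ) : ℂ) := by
    funext U
    rw [polDiff_configDiagSwap, Complex.conj_ofReal, polDiff, hg]
    push_cast
    ring
  rw [hfun, wilsonExpectation_ofReal_eq ρ hρ β g, hg, integral_exp_mul_polPair hρ hval hne]

/-- **Negativity transfer.** If the four-term combination is negative, the RP form of the
Polyakov-pair witness is NOT `≥ 0` (in `Complex.partialOrder`). -/
theorem not_nonneg_wilsonExpectation_polDiff (hρ : Continuous ρ)
    (hval : ∀ g, ρ g = 1 ∨ ρ g = -1) (hne : ∃ g, ρ g = -1) (β : ℝ) (X Y : ZMod L × ZMod L)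
    (hneg : ksum (Real.tanh β) X.swap X - ksum (Real.tanh β) X.swap Y -
      ksum (Real.tanh β) Y.swap X + ksum (Real.tanh β) Y.swap Y < 0) :
    ¬ 0 ≤ wilsonExpectation ρ β
        (fun U => (starRingEnd ℂ) (polDiff ρ X Y (configDiagSwap 0 1 U)) * polDiff ρ X Y U) := by
  rw [wilsonExpectation_polDiff hρ hval hne β X Y, Complex.zero_le_real, not_le]
  obtain ⟨hZ0, hZtop⟩ := partitionFunction_ne_zero_ne_top (d := 3) (L := L) ρ hρ β
  have hZ : 0 < ((partitionFunction (d := 3) (L := L) ρ β)⁻¹).toReal :=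
    ENNReal.toReal_pos (ENNReal.inv_ne_zero.2 hZtop) (ENNReal.inv_ne_top.2 hZ0)
  have hc : 0 < (Real.exp (-β) * Real.cosh β) ^ Fintype.card (Plaquette 3 L) :=
    pow_pos (mul_pos (Real.exp_pos _) (Real.cosh_pos β)) _
  exact mul_neg_of_pos_of_neg hZ (mul_neg_of_pos_of_neg hc hneg)

end Witness

end DiagRPThree

end Summit.QuantumFields.GaugeBoot
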